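import Summits.QuantumAdvantage.QuantumAdvantage.Theorems.CharDialSymmetricFrob
import Mathlib.Data.Nat.Choose.Lucas
import HarnessLib

/-!
# The SECOND structure law on the SYMMETRIC class: a symmetric Boolean function of `𝔽_p`-degree `< 2p`
# is a function of the Hamming weight mod `p` (`p` odd, `n + 1 ≥ 3p`)
(cell decomp-qadv, lens 6 «barrier-complement carving», g20: the symmetric sector of the node's piece B
`FormReach.StructureLawTwoOdd`, decided — one notch above `SubChar.symmetric_frob` (degree `≤ p − 1`, lens-6 g8).)

Mechanism: Lucas at `2p`.  Above a vertex with `2p` spare zeros the top Möbius coefficient of a degree-`< 2p` function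
vanishes; for a layer-symmetric block of size `2p` it equals `[G 0] − 2·[G p] + [G 2p]` mod `p` (`p ∣ C(2p,t)` unless
`t ∈ {0, p, 2p}`, `C(2p,p) ≡ 2`), and three bits `a, b, c` with `a − 2b + c ≡ 0 (mod p)`, `p` odd, are EQUAL.  Hence the weight
profile of a symmetric `f` is `p`-periodic wherever `w + 2p ≤ n`, i.e. everywhere once `n + 1 ≥ 3p`.

* `SubChar.choose_two_mul_cast_eq_zero`, `SubChar.choose_two_mul_self_cast` — Lucas at `2p`;
* `SubChar.bool_eq_of_second_difference` — the three-bit lemma;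
* `SubChar.block_biperiodic` — the block lemma at size `2p` (degree `< 2p`);
* `SubChar.symmetric_frob_two` — **symmetric `f`, `HasDegF p f d`, `d < 2p`, `3p ≤ n + 1` ⇒ `f u = H (Σ u_i mod p)`**: in
  particular every symmetric cut of `𝔽_p`-degree `≤ 2p − 3` is ONE linear form (the symmetric sector of `StructureLawTwoOdd`
  with `K = 1`), and so is every symmetric quadratic-phase cut (degree `≤ 2p − 2 < 2p`).

0 sorry; no `instance`, no `notation`, no `native_decide`.
-/

namespace Summit.QuantumAdvantage.AdviceFreeQNC0

namespace SubChar

open Finset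
open Literature.Computability.MetaComplexity Literature.Computability.MetaComplexity.Smolensky
open SubLog

variable {n : ℕ}

/-- Lucas at `2p`, off-centre: `p ∣ C(2p, t)` for `0 < t < 2p`, `t ≠ p`. -/
theorem choose_two_mul_cast_eq_zero (p : ℕ) [hp : Fact p.Prime] (t : ℕ) (ht0 : 0 < t) (ht : t < 2 * p)
    (htp : t ≠ p) : (((2 * p).choose t : ℕ) : ZMod p) = 0 := by
  have h := (ZMod.natCast_eq_natCast_iff _ _ _).2
    (Choose.choose_modEq_choose_mod_mul_choose_div_nat (n := 2 * p) (k := t) (p := p))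
  rw [h, Nat.mul_mod_left]
  have htmod : 0 < t % p := by
    rcases Nat.eq_zero_or_pos (t % p) with h0 | h0
    · exfalso
      obtain ⟨c, hc⟩ := Nat.dvd_of_mod_eq_zero h0
      have hp0 := hp.out.pos
      rcases c with _ | _ | c
      · omega
      · simp at hc; exact htp hc
      · nlinarith
    · exact h0
  rw [Nat.choose_eq_zero_of_lt htmod, zero_mul, Nat.cast_zero]

/-- Lucas at `2p`, centre: `C(2p, p) ≡ 2 (mod p)`. -/
theorem choose_two_mul_self_cast (p : ℕ) [hp : Fact p.Prime] :
    (((2 * p).choose p : ℕ) : ZMod p) = 2 := by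
  have h := (ZMod.natCast_eq_natCast_iff _ _ _).2
    (Choose.choose_modEq_choose_mod_mul_choose_div_nat (n := 2 * p) (k := p) (p := p))
  rw [h, Nat.mul_mod_left, Nat.mod_self, Nat.choose_zero_right, Nat.mul_div_cancel _ hp.out.pos,
    Nat.div_self hp.out.pos]
  norm_num

/-- Three bits with vanishing second difference mod an odd prime are equal. -/
theorem bool_eq_of_second_difference (p : ℕ) [hp : Fact p.Prime] (hp2 : p ≠ 2) (a b c : Bool)
    (h : (if a = true then (1 : ZMod p) else 0) - 2 * (if b = true then (1 : ZMod p) else 0)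
      + (if c = true then (1 : ZMod p) else 0) = 0) : a = b ∧ c = b := by
  have h2 : (2 : ZMod p) ≠ 0 := by
    have h' : ((2 : ℕ) : ZMod p) ≠ 0 := by
      rw [Ne, ZMod.natCast_eq_zero_iff]
      intro hd
      have := Nat.le_of_dvd two_pos hd
      have := hp.out.two_le
      omega
    exact_mod_cast h'
  have h1 : (1 : ZMod p) ≠ 0 := one_ne_zero
  have hm1 : (-1 : ZMod p) ≠ 0 := neg_ne_zero.2 h1
  have hm2 : (-2 : ZMod p) ≠ 0 := neg_ne_zero.2 h2
  cases a <;> cases b <;> cases c <;> simp only [Bool.false_eq_true, if_false, if_true] at h <;>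
    first
    | exact ⟨rfl, rfl⟩
    | (exfalso; apply h1; linear_combination h)
    | (exfalso; apply hm1; linear_combination h)
    | (exfalso; apply h2; linear_combination h)
    | (exfalso; apply hm2; linear_combination h)

/-- **Block bi-periodicity below degree `2p`** (the block lemma at size `2p`): if `f` has `𝔽_p`-degree `≤ d < 2p`, `p` odd,
and is layer-symmetric on a block `Y` of `2p` coordinates that are `0` at `x`, then `f (x ∨ 1_Y) = f x` and `f (x ∨ 1_T) = f x`
for every `T ⊆ Y` of size `p`. -/
theorem block_biperiodic (p : ℕ) [hp : Fact p.Prime] (hp2 : p ≠ 2) {d : ℕ} (hdp : d + 1 ≤ 2 * p)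
    {f : (Fin n → Bool) → Bool} (hf : HasDegF p f d) (x : Fin n → Bool) (Y : Finset (Fin n))
    (hY : Y.card = 2 * p) (hx : ∀ i ∈ Y, x i = false)
    (hsym : ∀ T ⊆ Y, ∀ T' ⊆ Y, T.card = T'.card → f (setOn T x) = f (setOn T' x)) :
    f (setOn Y x) = f x ∧ ∀ T ⊆ Y, T.card = p → f (setOn T x) = f x := by
  classical
  let G : ℕ → Bool := fun t =>
    if h : ∃ T : Finset (Fin n), T ⊆ Y ∧ T.card = t then f (setOn (Classical.choose h) x) else false
  have hG : ∀ T ⊆ Y, f (setOn T x) = G T.card := by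
    intro T hT
    have h : ∃ T' : Finset (Fin n), T' ⊆ Y ∧ T'.card = T.card := ⟨T, hT, rfl⟩
    simp only [G, dif_pos h]
    exact hsym T hT _ (Classical.choose_spec h).1 (Classical.choose_spec h).2.symm
  have hG0 : f x = G 0 := by
    have h := hG ∅ (Finset.empty_subset _)
    rwa [setOn_empty, Finset.card_empty] at h
  have hGY : f (setOn Y x) = G (2 * p) := by rw [hG Y (Finset.Subset.refl Y), hY]
  have hr : HasDegF p (fun u => f (overOn Y x u)) d := hasDegF_overOn p Y x hf
  have hvert : ∀ T ⊆ Y, indR (ZMod p) (fun u => f (overOn Y x u)) (vert T) = if G T.card = true then 1 else 0 := by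
    intro T hT
    simp only [indR, overOn_vert hT hx, hG T hT]
  have htop : moeb (indR (ZMod p) (fun u => f (overOn Y x u))) Y = 0 :=
    moeb_eq_zero_of_mem_lowDeg ((hasDegF_iff_indR p _ d).1 hr) (by rw [hY]; omega)
  -- the Möbius coefficient of the block, via Lucas at 2p
  let c : ℕ → ZMod p := fun t => (-1 : ZMod p) ^ (2 * p - t) * (if G t = true then (1 : ZMod p) else 0)
  have hsum : moeb (indR (ZMod p) (fun u => f (overOn Y x u))) Y =
      ∑ t ∈ range (2 * p + 1), ((2 * p).choose t : ZMod p) * c t := by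
    unfold moeb
    have h1 : ∀ T ∈ Y.powerset, (-1 : ZMod p) ^ (Y.card - T.card) * indR (ZMod p) (fun u => f (overOn Y x u)) (vert T)
        = c T.card := by
      intro T hT
      simp only [c]
      rw [hvert T (Finset.mem_powerset.1 hT), hY]
    rw [Finset.sum_congr rfl h1, Finset.sum_powerset_apply_card c, hY]
    refine Finset.sum_congr rfl fun t _ => ?_
    rw [nsmul_eq_mul]
  have hodd : Odd p := hp.out.odd_of_ne_two hp2
  -- evaluate: only t = 0, p, 2p survive
  have heval : ∑ t ∈ range (2 * p + 1), ((2 * p).choose t : ZMod p) * c t =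
      (if G 0 = true then (1 : ZMod p) else 0) - 2 * (if G p = true then (1 : ZMod p) else 0)
        + (if G (2 * p) = true then (1 : ZMod p) else 0) := by
    have hp0 := hp.out.pos
    have hm0 : 0 ∈ range (2 * p + 1) := by simp
    have hmp : p ∈ (range (2 * p + 1)).erase 0 := Finset.mem_erase.2 ⟨by omega, by simp; omega⟩
    have hm2p : 2 * p ∈ ((range (2 * p + 1)).erase 0).erase p :=
      Finset.mem_erase.2 ⟨by omega, Finset.mem_erase.2 ⟨by omega, by simp⟩⟩
    rw [← Finset.add_sum_erase _ _ hm0, ← Finset.add_sum_erase _ _ hmp, ← Finset.add_sum_erase _ _ hm2p]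
    have hrest : ∑ t ∈ (((range (2 * p + 1)).erase 0).erase p).erase (2 * p), ((2 * p).choose t : ZMod p) * c t = 0 := by
      refine Finset.sum_eq_zero fun t ht => ?_
      simp only [Finset.mem_erase, mem_range] at ht
      rw [choose_two_mul_cast_eq_zero p t (by omega) (by omega) ht.2.1, zero_mul]
    rw [hrest, add_zero, Nat.choose_zero_right, Nat.choose_self, choose_two_mul_self_cast]
    have hpow1 : (-1 : ZMod p) ^ (2 * p - 0) = 1 := by rw [Nat.sub_zero, pow_mul]; simp
    have hpow2 : (-1 : ZMod p) ^ (2 * p - p) = -1 := by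
      rw [show 2 * p - p = p by omega]; exact hodd.neg_one_pow
    have hpow3 : (-1 : ZMod p) ^ (2 * p - 2 * p) = 1 := by rw [Nat.sub_self, pow_zero]
    simp only [c, hpow1, hpow2, hpow3, Nat.cast_one, one_mul]
    ring
  rw [hsum, heval] at htop
  have hbits := bool_eq_of_second_difference p hp2 _ _ _ htop
  refine ⟨?_, fun T hT hTc => ?_⟩
  · rw [hGY, hG0]; exact hbits.2.trans hbits.1.symm
  · rw [hG T hT, hTc, hG0]; exact hbits.1.symm

/-- **The second structure law on the symmetric class.**  For an odd prime `p`, a SYMMETRIC Boolean function of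
`𝔽_p`-degree `≤ d < 2p` on `n ≥ 3p − 1` bits is a function of the Hamming weight mod `p` — one linear form.  Covers every
symmetric cut of degree `≤ 2p − 3` (piece B of the lens-6 g20 node, symmetric sector, `K = 1`) and every symmetric
quadratic-phase cut (degree `≤ 2(p−1)`). -/
theorem symmetric_frob_two (p : ℕ) [hp : Fact p.Prime] (hp2 : p ≠ 2) {d : ℕ} (hdp : d + 1 ≤ 2 * p)
    (hn : 3 * p ≤ n + 1) (f : (Fin n → Bool) → Bool)
    (hsym : ∀ u v : Fin n → Bool, hw u = hw v → f u = f v) (hf : HasDegF p f d) :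
    ∃ H : ZMod p → Bool, ∀ u, f u = H (∑ i, if u i then (1 : ZMod p) else 0) := by
  classical
  -- the weight profile
  let Φ : ℕ → Bool := fun w => if h : ∃ u : Fin n → Bool, hw u = w then f (Classical.choose h) else false
  have hΦ : ∀ u, f u = Φ (hw u) := by
    intro u
    have h : ∃ v : Fin n → Bool, hw v = hw u := ⟨u, rfl⟩
    simp only [Φ, dif_pos h]
    exact hsym u _ (Classical.choose_spec h).symm
  -- bi-periodicity: Φ (w + p) = Φ w and Φ (w + 2p) = Φ w whenever w + 2p ≤ n
  have hper : ∀ w, w + 2 * p ≤ n → Φ (w + p) = Φ w ∧ Φ (w + 2 * p) = Φ w := by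
    intro w hwn
    obtain ⟨T, -, hTcard⟩ := Finset.exists_subset_card_eq (s := (univ : Finset (Fin n))) (n := w) (by simp; omega)
    let u : Fin n → Bool := SubLog.vert T
    have hu : hw u = w := by rw [hw_vert, hTcard]
    have hZ : 2 * p ≤ (univ.filter fun i => u i = false).card := by
      have h1 : (univ.filter fun i => u i = false) = (univ.filter fun i => u i = true)ᶜ := by
        ext i; simp
      rw [h1, Finset.card_compl, Fintype.card_fin]
      have : (univ.filter fun i => u i = true).card = w := hu
      omega
    obtain ⟨Y, hYsub, hYcard⟩ := Finset.exists_subset_card_eq hZ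
    have hY0 : ∀ i ∈ Y, u i = false := by
      intro i hi
      have := hYsub hi
      simpa using this
    have hblock := block_biperiodic p hp2 hdp hf u Y hYcard hY0
      (fun T₁ hT₁ T₂ hT₂ hc => hsym _ _ (by
        rw [hw_setOn (fun i hi => hY0 i (hT₁ hi)), hw_setOn (fun i hi => hY0 i (hT₂ hi)), hc]))
    obtain ⟨T', hT'sub, hT'card⟩ := Finset.exists_subset_card_eq (s := Y) (n := p) (by omega)
    have hwY : hw (setOn Y u) = w + 2 * p := by rw [hw_setOn hY0, hu, hYcard]
    have hwT' : hw (setOn T' u) = w + p := by rw [hw_setOn (fun i hi => hY0 i (hT'sub hi)), hu, hT'card]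
    refine ⟨?_, ?_⟩
    · rw [← hwT', ← hu, ← hΦ, ← hΦ]; exact hblock.2 T' hT'sub hT'card
    · rw [← hwY, ← hu, ← hΦ, ← hΦ]; exact hblock.1
  -- hence Φ w = Φ (w % p) for w ≤ n (uses n + 1 ≥ 3p)
  have hmod : ∀ w, w ≤ n → Φ w = Φ (w % p) := by
    intro w
    induction w using Nat.strong_induction_on with
    | _ w ih =>
      intro hwn
      have hp0 := hp.out.pos
      by_cases hlt : w < p
      · rw [Nat.mod_eq_of_lt hlt]
      · have hpw : p ≤ w := Nat.le_of_not_lt hlt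
        by_cases hfit : w + p ≤ n
        · -- base w - p has base + 2p = w + p ≤ n
          have h1 : Φ w = Φ (w - p) := by
            have := (hper (w - p) (by omega)).1
            rwa [Nat.sub_add_cancel hpw] at this
          rw [h1, ih (w - p) (by omega) (by omega), Nat.mod_eq_sub_mod hpw]
        · -- w + p > n ≥ 3p - 1, so w ≥ 2p; base w - 2p has base + 2p = w ≤ n
          have h2pw : 2 * p ≤ w := by omega
          have h1 : Φ w = Φ (w - 2 * p) := by
            have := (hper (w - 2 * p) (by omega)).2
            rwa [Nat.sub_add_cancel h2pw] at this
          rw [h1, ih (w - 2 * p) (by omega) (by omega)]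
          have e : (w - 2 * p + 2 * p) % p = (w - 2 * p) % p := Nat.add_mul_mod_self_right _ _ _
          rw [Nat.sub_add_cancel h2pw] at e
          rw [e]
  refine ⟨fun s => Φ s.val, fun u => ?_⟩
  show f u = Φ (ZMod.val (∑ i, if u i then (1 : ZMod p) else 0))
  rw [← natCast_hw, ZMod.val_natCast, hΦ u]
  exact hmod _ (hw_le u)

end SubChar

end Summit.QuantumAdvantage.AdviceFreeQNC0
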